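import Literature.MathematicalPhysics.QuantumFieldTheory.Balaban1983to89.B9SectBCodedFamiliesUParH
import Literature.MathematicalPhysics.QuantumFieldTheory.Balaban1983to89.B9SectBParSelY

/-!
# `Balaban1983to89.B9SectBFramesSelY` — T. Bałaban, *Propagators for lattice gauge theories in a background field*, Commun. Math. Phys. **99** (1985)
# 389–434 [Balaban1985BackgroundPropagators], Thm 3.4 p. 400, Sect. B pp. 400–407, (3.19)–(3.21) pp. 393–394, (3.35)–(3.37) p. 396: THE G′-SIDE
# SECT.-B FRAME CONSTRUCTORS WITH THE AVERAGING-TRANSPORTER LAWS GUARDED BY (3.35) (pub-ymgap N06 [B9]; cure (α) of ⚑ LOCATED-29, module S1)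

statement-level skeleton of published theorems with citation tags; proofs where landed; nothing here is a claim about the Yang–Mills mass gap

THE PRINT.  Sect. B (pp. 400–407) proves Theorem 3.4 for configurations `U` satisfying (3.35) («U … with values in G», p. 396) and `U′` in (3.37); every use
of the sizes (3.19)∕(3.24) of the averaging operators and of Theorem 3.11 (invertibility of `Δ′_a(U)`, `(Q′G′²Q′*)(U)`) is AT SUCH configurations.

WHY THIS FILE (pub-ymgap node N06 [B9]; director-ym №383 CASCADE-K, seat dag-n06-c; ⚑ LOCATED-29 + node00-def-Y's RULING (α)).  The tree's frame
constructors `B9SectBCodedChainOnSubfamilyR.gpFrame₂CodedOn`, `B9SectBCodedChainAnR.anFrame₂CodedOn`, `B9SectBKerFrameCodedYR.cinvFrame₃CodedOn`,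
`B9SectBE4FrameCodedYR.e4Frame₃CodedOn` DISPLAY the three averaging-transporter laws `hpar` (values in `G`), `hunit` (`Δ′_a(U)` a unit), `hunitX`
(`(Q′G′²Q′*)(U)` a unit) AT EVERY `G`-VALUED configuration; at B8's knit transporter `parKnitY` these are theorems on the (3.35)∕[5] (52) regime only.  THIS
FILE re-threads the four constructors with the laws GUARDED by print's class — `hparG ∕ hunitG ∕ hunitXG : ∀ j α₀ U, MInv ≤ M_j → 0 < α₀ → M_j·α₀ ≤ aInv →
(bg9YC 𝔸 G P (f j)).Reg335 c35 α₀ U → …` (the guard of the frames' `reg_inv ∕ reg_cinv`), plus `hparC : C37 j β U a → ∀ z w, par j U z w ∈ G` (the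
averaging transporters are `G`-valued at the base of every (3.37) pair) — WITHOUT changing any frame structure or generic step theorem: every letter is fed
the SELECTED transporter `B9SectBParSelY.parSelC` of the coded configuration (= `par` on the regime, the identity transporter off it), the size fields
`hkQ ∕ hsQ` hold unconditionally (`kQC_norm_le_sel`), the transporter-generic fields (`gop_eq`, `mul_law`, `cop_eq`, `q_mul`, `readKer`, …) take the
selected transporter verbatim, and the fields proved from a displayed `par`-law (`reg_inv`, `read342`, `write342`, `cplx`, `hQc`, `hQcs`, `reg_cinv`, `hF`,
`writeKer`, `writeAn`, `e4_transfer`) sit under (3.35)+thresholds or under `C37`, derive the regime, rewrite `parSelC = par` (`selY_of_inRegY`) and reuse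
the landed proof terms.  Structure types, type indices (families `KC ∕ KSC ∕ KSC₆`, pins `IsAnKY par`, `pullS (CinvY … par)`) are those of the originals.

CONTENTS.  §1 `gpFrame₂CodedOnSel` (root frame, any coded family `KC` with displayed dictionaries); §2 `anFrame₂CodedOnSel`; §3 `cinvFrame₃CodedOnSel` (family
`KSC`, kernel `pullS (CinvY … par)`); §4 `e4Frame₃CodedOnSel` (family `KSC₆`).

HONEST SCOPE.  Re-threading bookkeeping over NODE 00's DEFINED letters; every field is the original's proof term at the selected transporter; nothing of [B9] is
asserted beyond the originals' displayed hypotheses (now weaker); COUNT-NEUTRAL; N06 NOT discharged; one finite lattice programme — nothing continuum ∕ OS ∕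
mass-gap ∕ Clay.  Cell `pub-ymgap` (HUMAN RULING D-0062), Track A node N06 [B9], CASCADE-K (№383), cure (α) of LOCATED-29, module S1.

RELATED IN THE TREE, NOT DUPLICATED: the four originals (namespaces above; their R-free twins `B9SectBCodedChainOnSubfamily` ∕ `B9SectBCodedChainAn` ∕
`B9SectBKerFrameCodedY` ∕ `B9SectBE4FrameCodedY`), `B9SectBParSelY` (the device), `B9SectBGpLettersY` ∕ `B9SectBKerLettersY` ∕ `B9SectBE4FrameCodedY` (letters and
field lemmas), `B9SectBGpStepAtLettersV2` (`GpFrame₂`, `AnFrame₂`), `B9SectBKerFrameV3` (`CinvFrame₃`), `B9SectBE4FrameCodedY` (`E4Frame₃`) — USED BY NAME; no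
existing module modified.
-/

noncomputable section

namespace Literature.MathematicalPhysics.QuantumFieldTheory.Balaban1983to89.B9SectBFramesSelY

open Literature.MathematicalPhysics.QuantumFieldTheory.Balaban1983to89.B9SectBCodedClassR (RegExtraY bg9YC)
open Literature.MathematicalPhysics.QuantumFieldTheory.Balaban1983to89.B9SectBParSelY
open Literature.MathematicalPhysics.QuantumFieldTheory.Balaban1983to89.B6KLevelCensusIndexV1 (KIdx kGeo)
open Literature.MathematicalPhysics.QuantumFieldTheory.Balaban1983to89.B6Ineq2142KLevelV1 (β)
open Literature.MathematicalPhysics.QuantumFieldTheory.Balaban1983to89.B6RandomWalk (HasMajorant Ineq261 BlockSupp hasMajorant_mono)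
open Literature.MathematicalPhysics.QuantumFieldTheory.Balaban1983to89.B6RandomWalkHom (HasMajorantHom hasMajorantHom_mono)
open Literature.MathematicalPhysics.QuantumFieldTheory.Balaban1983to89.B9Thm34Ext (toB6)
open Literature.MathematicalPhysics.QuantumFieldTheory.Balaban1983to89.B9FromB6 (EBlock)
open Literature.MathematicalPhysics.QuantumFieldTheory.Balaban1983to89.B9SectBCodedCarrier (CCfg Coding pullK pullS)
open Literature.MathematicalPhysics.QuantumFieldTheory.Balaban1983to89.B9SectBGpStepAtLettersV2 (GpFrame₂ AnFrame₂)
open Literature.MathematicalPhysics.QuantumFieldTheory.Balaban1983to89.B9Eq360DeltaPrimeAY (AfldY mulY)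
open Literature.MathematicalPhysics.QuantumFieldTheory.Balaban1983to89.B9PinMembersKLevelV1 (MemberY geo9Y bg9Y)
open Literature.MathematicalPhysics.QuantumFieldTheory.Balaban1983to89.B9SectBGpLettersY
open Literature.MathematicalPhysics.QuantumFieldTheory.Balaban1983to89.B9SectBGpFrameCodedYR (codingYx Read342Y Write342Y)
open Literature.MathematicalPhysics.QuantumFieldTheory.Balaban1983to89.B9SectBGpFrameCodedY (CplxLettersY exists_d261)
open Literature.MathematicalPhysics.QuantumFieldTheory.Balaban1983to89.B9RWSums347DefiniteFacesWindow (scaleTransfer6_window_geo9Y geo9Y_dist_nonneg)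
open Literature.MathematicalPhysics.QuantumFieldTheory.Balaban1983to89.B9GeoLemma21KLevelV1 (geo9Y_dist_self geo9Y_dist_comm geo9Y_dist_triangle geo9Y_len_pos
  geo9K_eta_pos geo9K_one_le_L)
open Literature.MathematicalPhysics.QuantumFieldTheory.Balaban1983to89.B9SectBCodedChainAnR (IsAnKY)
open Literature.MathematicalPhysics.QuantumFieldTheory.Balaban1983to89.B9SectBGpReadingsYR (KSC read342Y_KSC write342Y_KSC)
open Literature.MathematicalPhysics.QuantumFieldTheory.Balaban1983to89.B9SectBKerFrameV3 (CinvFrame₃)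
open Literature.MathematicalPhysics.QuantumFieldTheory.Balaban1983to89.B9SectBKerFrameCodedYR (CinvY pullS_CinvY_ker)
open Literature.MathematicalPhysics.QuantumFieldTheory.Balaban1983to89.B9SectBKerFrameCodedY (kerCY kerCY_nonneg kerCY_le_of_hasMajorant_CopC hasMajorant_CopC_base
  VarParY varParY_of_cplxLettersY hasMajorantHom_FcC hasMajorantHom_FcsC)
open Literature.MathematicalPhysics.QuantumFieldTheory.Balaban1983to89.B9SectBKerLettersY (QcC QcsC CopC FcC FcsC copC_eq XC_mul_CopC qcC_prod qcsC_prod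
  hasMajorantHom_QcC_base hasMajorantHom_QcsC_base)
open Literature.MathematicalPhysics.QuantumFieldTheory.Balaban1983to89.B9SectBE4FrameCodedYR (KSC₆ read342Y_KSC₆ write342Y_KSC₆ e4_transfer_KSC₆)
open Literature.MathematicalPhysics.QuantumFieldTheory.Balaban1983to89.B9SectBE4FrameCodedY (E4Frame₃ wE4₆)
open Literature.MathematicalPhysics.QuantumFieldTheory.Balaban1983to89.B9GeoNormsKLevelV1 (geo9K)
open Literature.MathematicalPhysics.QuantumFieldTheory.Balaban1983to89.Node00 (SiteY BlkY IBondY CfgY SiteParY BondOpY BondParY shiftY deltaPrimeAY kernelFamilyS GpY XY)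

variable {d ℓ : ℕ} {hd : 1 ≤ d + 1} {hL : Odd (ℓ + 1) ∧ 1 < ℓ + 1} {b₀ b₁ : ℝ} {Mstar : ℕ}
variable {𝔸 : Type} [NormedRing 𝔸] (P : RegExtraY d ℓ hd hL b₀ b₁ Mstar 𝔸) [NormedAlgebra ℂ 𝔸] [CompleteSpace 𝔸]

/-! ## §1 The root frame with guarded transporter laws -/

section RootFrame

variable [NormOneClass 𝔸] {J : Type} (f : J → MemberY d ℓ hd hL b₀ b₁ Mstar)
  (c35 : ℝ) (G : Subgroup 𝔸ˣ) {ι : Type} [Fintype ι] [DecidableEq ι] (b : Module.Basis ι ℝ 𝔸)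
  [∀ x : MemberY d ℓ hd hL b₀ b₁ Mstar, Fintype (geo9Y x).Site] [instDS : ∀ x : MemberY d ℓ hd hL b₀ b₁ Mstar, DecidableEq (geo9Y x).Site]
  [∀ x : MemberY d ℓ hd hL b₀ b₁ Mstar, Nonempty (geo9Y x).Site]
  (C37 C38 : ∀ j : J, ℝ → CfgY 𝔸 (f j).toKIdx → AfldY 𝔸 (f j).toKIdx → Prop)
  (par : ∀ j : J, SiteParY 𝔸 (f j).toKIdx)
  (ιB : ∀ j : J, BlkY (f j).toKIdx → IBondY (f j).toKIdx)
  (KC : ∀ j : J, B9.KernelFamily (geo9Y (f j)) (codingYx P G (f j) (C37 j) (C38 j)).bg)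

/-- ★ **THE ROOT SECT.-B FRAME `GpFrame₂` OVER THE CODED CARRIERS OF A SUBFAMILY, TRANSPORTER LAWS GUARDED** — `B9SectBCodedChainOnSubfamilyR.gpFrame₂CodedOn`
with every letter read at the selected transporter `parSelC G _ (par j) c` of the coded configuration, the membership law displayed GUARDED (`hparG`: at
(3.35)-regular `U` above the thresholds `MInv`, `aInv`; `hparC`: at the base of a (3.37) pair) and Theorem 3.11's invertibility displayed GUARDED (`hunitG`);
all constants, data shapes and the dictionaries `hread ∕ hwrite` as in the original. [cite: Balaban1985BackgroundPropagators, Thm 3.4 p.400, (3.60) p.402, Thm 3.1 (3.42) p.397, (3.19) p.393, (3.35)–(3.37) p.396, Thm 3.11 p.416; Balaban1984PropagatorsII, Lemma 2.1 p.234, (2.51) p.232] -/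
noncomputable def gpFrame₂CodedOnSel (hι : ∀ (j : J) (s : BlkY (f j).toKIdx), β (f j).toKIdx.hN (f j).toKIdx.D (f j).toKIdx.hk (ιB j s) = s)
    (hG1 : ∀ u : 𝔸ˣ, u ∈ G → ‖(u : 𝔸)‖ ≤ 1)
    (dB : ℕ) (M₂ : ℝ) (hM₂ : 0 ≤ M₂) (hrepr : ∀ (v : 𝔸) (j : ι), |b.repr v j| ≤ M₂ * ‖v‖)
    (Cq : ℝ) (hCq : 0 ≤ Cq) (hC37 : ∀ j β' U a, C37 j β' U a → GVal G (f j).toKIdx U ∧ CplxLettersY G (f j) (par j) (ιB j) Cq β' U a)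
    (cR : ℝ) (hcR : 0 < cR) (wBf : ℝ → ℝ → ℝ) (hwBf : ∀ B δ : ℝ, 0 ≤ B → 0 < δ → 0 < wBf B δ) (wδf : ℝ → ℝ) (hwδf : ∀ δ : ℝ, 0 < δ → 0 < wδf δ)
    (MInv aInv aW : ℝ) (hMInv : 0 < MInv) (haInv : 0 < aInv) (haW : 0 < aW)
    (hparG : ∀ j (α₀ : ℝ) (U : CfgY 𝔸 (f j).toKIdx), MInv ≤ (geo9Y (f j)).M → 0 < α₀ → (geo9Y (f j)).M * α₀ ≤ aInv →
      (bg9YC 𝔸 G P (f j)).Reg335 c35 α₀ U → ∀ z w, par j U z w ∈ G)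
    (hparC : ∀ j β' U a, C37 j β' U a → ∀ z w, par j U z w ∈ G)
    (hunitG : ∀ j (α₀ : ℝ) (U : CfgY 𝔸 (f j).toKIdx), MInv ≤ (geo9Y (f j)).M → 0 < α₀ → (geo9Y (f j)).M * α₀ ≤ aInv →
      (bg9YC 𝔸 G P (f j)).Reg335 c35 α₀ U → IsUnit (deltaPrimeAY (f j).toKIdx (par j) U))
    (hread : ∀ j, Read342Y P G (f j) (par j) b (ιB j) (C37 j) (C38 j) (KC j) c35 cR MInv aInv 0 True)
    (hwrite : ∀ j, Write342Y P G (f j) (par j) b (ιB j) (C37 j) (C38 j) (KC j) wBf wδf aW 0 True) :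
    GpFrame₂ c35 (fun j => geo9Y (f j)) (fun j => (codingYx P G (f j) (C37 j) (C38 j)).bg) KC b (Fin (d + 1)) (fun j => SiteY (f j).toKIdx) where
  dB := dB
  Cq := Cq
  a₀ := 1
  d₀ := 2 * ((d : ℝ) + 1)
  M₂ := M₂
  Λf := fun _ _ => ((ℓ : ℝ) + 1) ^ 4
  cR := cR
  wB := wBf
  wδ := wδf
  MInv := MInv
  aInv := aInv
  aW := aW
  δcap := 1
  M261 := Classical.choose (Classical.choose_spec (exists_d261 (d := d) (ℓ := ℓ) (hd := hd) (hL := hL) (b₀ := b₀) (b₁ := b₁) (Mstar := Mstar)))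
  MST := fun δ => 4 * Real.log ((ℓ : ℝ) + 1) / (9 / 5000 * δ)
  d261 := Classical.choose (exists_d261 (d := d) (ℓ := ℓ) (hd := hd) (hL := hL) (b₀ := b₀) (b₁ := b₁) (Mstar := Mstar))
  Cq_nonneg := hCq
  a₀_nonneg := zero_le_one
  M₂_nonneg := hM₂
  Λf_one_le := fun _ _ _ _ => one_le_pow₀ (by have : (0 : ℝ) ≤ ℓ := Nat.cast_nonneg _; linarith)
  cR_pos := hcR
  wB_pos := hwBf
  wδ_pos := hwδf
  MInv_pos := hMInv
  aInv_pos := haInv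
  aW_pos := haW
  δcap_pos := one_pos
  hrepr := hrepr
  T := fun j => shiftY (f j).toKIdx
  blk := fun j => blkC (f j).toKIdx (ιB j)
  Rr := fun _ => 0
  Hp := fun _ => True
  coord := fun j => coordC G (f j).toKIdx
  kQ := fun j c => kQC G (f j).toKIdx (parSelC G (f j).toKIdx (par j) c) c
  sQ := fun j c => sQC G (f j).toKIdx (parSelC G (f j).toKIdx (par j) c) c
  w := fun j => wC (f j).toKIdx
  cfun := fun j => cfunC (f j).toKIdx
  expA := fun j => expAC (f j).toKIdx
  kF := fun j c c' => kFC (f j).toKIdx (parSelC G (f j).toKIdx (par j) c) c c'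
  sF := fun j c c' => sFC (f j).toKIdx (parSelC G (f j).toKIdx (par j) c) c c'
  Δp := fun j c => ΔpC (f j).toKIdx (parSelC G (f j).toKIdx (par j) c) b c
  Gop := fun j c => GopC (f j).toKIdx (parSelC G (f j).toKIdx (par j) c) b c
  Lap := fun j => LapC (f j).toKIdx b
  dist_nonneg := fun j => geo9Y_dist_nonneg (f j)
  triangle := fun j => fun a bb c => geo9Y_dist_triangle (f j) a bb c
  dist_self := fun j => geo9Y_dist_self (f j)
  dist_comm := fun j => geo9Y_dist_comm (f j)
  len_pos := fun j => geo9Y_len_pos (f j)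
  eta_le_len := fun j y => by
    show (geo9Y (f j)).eta ≤ (geo9Y (f j)).L ^ (geo9Y (f j)).scale y * (geo9Y (f j)).eta
    exact le_mul_of_one_le_left (geo9K_eta_pos (f j).toKIdx).le (one_le_pow₀ (geo9K_one_le_L (f j).toKIdx))
  eta_pos := fun j => geo9K_eta_pos (f j).toKIdx
  h261 := fun j δ α hδ _ hα hα1 hM =>
    Classical.choose_spec (Classical.choose_spec (exists_d261 (d := d) (ℓ := ℓ) (hd := hd) (hL := hL) (b₀ := b₀) (b₁ := b₁) (Mstar := Mstar)))
      (f j) δ α hδ hα hα1.le hM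
  hST := fun j δ α hδ _ hα hM => by
    have hκlo : 0 < 9 / 5000 * δ := by positivity
    have hκ : 9 / 5000 * δ ≤ α * δ := mul_le_mul_of_nonneg_right hα hδ.le
    exact scaleTransfer6_window_geo9Y hκlo (f j) hκ hM
  unitary := fun j c m z => coordC_unitary G (f j).toKIdx hG1 c m z
  stencilB := fun j μ z => stencilB_blkC (f j).toKIdx (ιB j) (hι j) μ z
  stencilF := fun j μ z => stencilF_blkC (f j).toKIdx (ιB j) (hι j) μ z
  stencil0 := fun j y => stencil0_geo9K (f j).toKIdx y
  w_nonneg := fun j c y => wC_nonneg (f j).toKIdx c y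
  card_w := fun j c y => card_blkC_mul_wC_le (f j).toKIdx (ιB j) (instD := instDS (f j)) (hι j) c y
  hkQ := fun j c y z _ => kQC_norm_le_sel G (f j).toKIdx (par j) hG1 c y z
  hsQ := fun j c z => sQC_norm_le_sel G (f j).toKIdx (par j) hG1 c z
  hcfun := fun j y => cfunC_abs_le (f j).toKIdx y
  gop_eq := fun j c D X hD hDX hXD => gopC_eq (f j).toKIdx (parSelC G (f j).toKIdx (par j) c) b c D X hD hDX hXD
  reg_inv := fun j α₀ c hM hα₀ hMa hreg => by
    obtain ⟨U, rfl, hU⟩ := (codingYx P G (f j) (C37 j) (C38 j)).exists_of_bg_Reg335 hreg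
    have hR : InRegY G (f j).toKIdx (par j) U := ⟨hU.1.1, hparG j α₀ U hM hα₀ hMa hU⟩
    erw [parSelC_base_of_inRegY G (f j).toKIdx (par j) hR]
    exact ΔpC_mul_GopC (f j).toKIdx (par j) b (.base U) (hunitG j α₀ U hM hα₀ hMa hU)
  cplx := fun j α₁ c c' _ h37 => by
    obtain ⟨U, a, rfl, rfl, hC⟩ := (codingYx P G (f j) (C37 j) (C38 j)).exists_of_bg_Cplx337 h37
    have hR : InRegY G (f j).toKIdx (par j) U := ⟨(hC37 j α₁ U a hC).1, hparC j α₁ U a hC⟩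
    erw [parSelC_base_of_inRegY G (f j).toKIdx (par j) hR]
    exact (hC37 j α₁ U a hC).2
  mul_law := fun j α₁ c c' _ h37 => by
    obtain ⟨U, a, rfl, rfl, hC⟩ := (codingYx P G (f j) (C37 j) (C38 j)).exists_of_bg_Cplx337 h37
    exact ΔpC_mul_law G (f j).toKIdx (selY G (f j).toKIdx (par j) U) b (ιB j) (instD := instDS (f j)) (hι j) (hC37 j α₁ U a hC).1 a
  read342 := fun j α₀ c B₀ δ hM hα₀ hMa hreg hB₀ hδ hE => by
    obtain ⟨U, rfl, hU⟩ := (codingYx P G (f j) (C37 j) (C38 j)).exists_of_bg_Reg335 hreg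
    have hR : InRegY G (f j).toKIdx (par j) U := ⟨hU.1.1, hparG j α₀ U hM hα₀ hMa hU⟩
    erw [parSelC_base_of_inRegY G (f j).toKIdx (par j) hR]
    exact hread j α₀ U B₀ δ hM hα₀ hMa hU hB₀ hδ hE
  write342 := fun j c c' α₁ B δ hα₁ hα₁W h37 hB hδ => by
    obtain ⟨U, a, rfl, rfl, hC⟩ := (codingYx P G (f j) (C37 j) (C38 j)).exists_of_bg_Cplx337 h37
    have hR : InRegY G (f j).toKIdx (par j) U := ⟨(hC37 j α₁ U a hC).1, hparC j α₁ U a hC⟩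
    erw [parSelC_prod_of_inRegY G (f j).toKIdx (par j) hR]
    exact hwrite j U a α₁ B δ hα₁ hα₁W hC hB hδ



/-- ★ **THE ANALYTIC-EXTENSION FRAME `AnFrame₂` OVER THE CODED CARRIERS OF A SUBFAMILY, TRANSPORTER LAWS GUARDED** — `B9SectBCodedChainAnR.anFrame₂CodedOn` on the root
`gpFrame₂CodedOnSel`; the pin `IsAnKY … (par j)` AT `par` (the type index is unchanged); `writeAn` holds at the base of a (3.37) pair, where the selected
transporter IS `par` (`hparC`). [cite: Balaban1985BackgroundPropagators, Thm 3.4 p.400, (3.62)–(3.64) p.402, (3.35)–(3.37) p.396; Balaban1984PropagatorsII, Lemma 2.1 p.234] -/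
noncomputable def anFrame₂CodedOnSel (hι : ∀ (j : J) (s : BlkY (f j).toKIdx), β (f j).toKIdx.hN (f j).toKIdx.D (f j).toKIdx.hk (ιB j s) = s)
    (hG1 : ∀ u : 𝔸ˣ, u ∈ G → ‖(u : 𝔸)‖ ≤ 1)
    (dB : ℕ) (M₂ : ℝ) (hM₂ : 0 ≤ M₂) (hrepr : ∀ (v : 𝔸) (j : ι), |b.repr v j| ≤ M₂ * ‖v‖)
    (Cq : ℝ) (hCq : 0 ≤ Cq) (hC37 : ∀ j β' U a, C37 j β' U a → GVal G (f j).toKIdx U ∧ CplxLettersY G (f j) (par j) (ιB j) Cq β' U a)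
    (cR : ℝ) (hcR : 0 < cR) (wBf : ℝ → ℝ → ℝ) (hwBf : ∀ B δ : ℝ, 0 ≤ B → 0 < δ → 0 < wBf B δ) (wδf : ℝ → ℝ) (hwδf : ∀ δ : ℝ, 0 < δ → 0 < wδf δ)
    (MInv aInv aW : ℝ) (hMInv : 0 < MInv) (haInv : 0 < aInv) (haW : 0 < aW)
    (hparG : ∀ j (α₀ : ℝ) (U : CfgY 𝔸 (f j).toKIdx), MInv ≤ (geo9Y (f j)).M → 0 < α₀ → (geo9Y (f j)).M * α₀ ≤ aInv →
      (bg9YC 𝔸 G P (f j)).Reg335 c35 α₀ U → ∀ z w, par j U z w ∈ G)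
    (hparC : ∀ j β' U a, C37 j β' U a → ∀ z w, par j U z w ∈ G)
    (hunitG : ∀ j (α₀ : ℝ) (U : CfgY 𝔸 (f j).toKIdx), MInv ≤ (geo9Y (f j)).M → 0 < α₀ → (geo9Y (f j)).M * α₀ ≤ aInv →
      (bg9YC 𝔸 G P (f j)).Reg335 c35 α₀ U → IsUnit (deltaPrimeAY (f j).toKIdx (par j) U))
    (hread : ∀ j, Read342Y P G (f j) (par j) b (ιB j) (C37 j) (C38 j) (KC j) c35 cR MInv aInv 0 True)
    (hwrite : ∀ j, Write342Y P G (f j) (par j) b (ιB j) (C37 j) (C38 j) (KC j) wBf wδf aW 0 True) :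
    AnFrame₂ c35 (fun j => geo9Y (f j)) (fun j => (codingYx P G (f j) (C37 j) (C38 j)).bg) KC b (Fin (d + 1)) (fun j => SiteY (f j).toKIdx)
      (fun j => IsAnKY P G (f j) (par j) b (C37 j) (C38 j)) :=
  { gpFrame₂CodedOnSel P f c35 G b C37 C38 par ιB KC hι hG1 dB M₂ hM₂ hrepr Cq hCq hC37 cR hcR wBf hwBf wδf hwδf MInv aInv aW hMInv haInv haW
      hparG hparC hunitG hread hwrite with
    writeAn := fun j α₀ c α₁ _ _ _ hreg _ _ H => by
      obtain ⟨U, rfl, -⟩ := (codingYx P G (f j) (C37 j) (C38 j)).exists_of_bg_Reg335 hreg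
      intro a ha
      have hR : InRegY G (f j).toKIdx (par j) U := ⟨(hC37 j α₁ U a ha).1, hparC j α₁ U a ha⟩
      have h := H (.mult a) (((codingYx P G (f j) (C37 j) (C38 j)).bg_Cplx337_base_mult α₁ U a).2 ha)
      dsimp only [gpFrame₂CodedOnSel] at h
      erw [parSelC_prod_of_inRegY G (f j).toKIdx (par j) hR] at h
      exact h }

end RootFrame

/-! ## §2 The C⁻¹ letters dictionary with guarded transporter laws -/

section Ker

variable [NormOneClass 𝔸] [FiniteDimensional ℝ 𝔸] {J : Type} (f : J → MemberY d ℓ hd hL b₀ b₁ Mstar)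
  [∀ x : MemberY d ℓ hd hL b₀ b₁ Mstar, Fintype (geo9Y x).Site]
  [instDS : ∀ x : MemberY d ℓ hd hL b₀ b₁ Mstar, DecidableEq (geo9Y x).Site] [instNE : ∀ x : MemberY d ℓ hd hL b₀ b₁ Mstar, Nonempty (geo9Y x).Site]
  (c35 : ℝ) (G : Subgroup 𝔸ˣ) (par : ∀ j : J, SiteParY 𝔸 (f j).toKIdx)
  {ι : Type} [Fintype ι] [DecidableEq ι] (b : Module.Basis ι ℝ 𝔸)
  (ιB : ∀ j : J, BlkY (f j).toKIdx → IBondY (f j).toKIdx)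
  (C37 C38 : ∀ j : J, ℝ → CfgY 𝔸 (f j).toKIdx → AfldY 𝔸 (f j).toKIdx → Prop)
set_option maxHeartbeats 400000 in
/-- ★★ **THE LETTERS DICTIONARY `CinvFrame₃` OVER THE CODED CARRIERS OF A SUBFAMILY, TRANSPORTER LAWS GUARDED** — `B9SectBKerFrameCodedYR.cinvFrame₃CodedOn` (family
`KSC … (par j)`, kernel `pullS 𝔠 (CinvY … par j)`, letters `QcC ∕ QcsC ∕ CopC ∕ FcC ∕ FcsC` read at the selected transporter) with `hparG ∕ hparC ∕ hunitG` and the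
invertibility of `(Q′G′²Q′*)(U)` displayed GUARDED (`hunitXG`, Thm 3.11's regime); the reversal law `hsym` as in the original.  `hQc ∕ hQcs` need no law at all
(the selected transporter is `G`-valued at its own base); `reg_cinv ∕ readKer` derive the regime from `hparG`, `hF ∕ writeKer` from `hparC`.
[cite: Balaban1985BackgroundPropagators, Thm 3.2 (3.48) p.398, (3.19)–(3.21) pp.393–394, (3.57)–(3.59) pp.401–402, (3.65)–(3.67) p.403, Thm 3.11 p.416, (3.35)–(3.37) p.396; Balaban1984PropagatorsII, (2.51) p.232, (2.69) p.235] -/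
noncomputable def cinvFrame₃CodedOnSel (hι : ∀ (j : J) (s : BlkY (f j).toKIdx), β (f j).toKIdx.hN (f j).toKIdx.D (f j).toKIdx.hk (ιB j s) = s)
    (hG1 : ∀ u : 𝔸ˣ, u ∈ G → ‖(u : 𝔸)‖ ≤ 1)
    (M₂ : ℝ) (hM₂ : 0 ≤ M₂) (hrepr : ∀ (v : 𝔸) (j : ι), |b.repr v j| ≤ M₂ * ‖v‖) (hcR : 0 < M₂ * ∑ j, ‖b j‖)
    (Cq : ℝ) (hCq : 0 ≤ Cq) (hC37 : ∀ j β' U a, C37 j β' U a → GVal G (f j).toKIdx U ∧ CplxLettersY G (f j) (par j) (ιB j) Cq β' U a)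
    (MInv aInv aW : ℝ) (hMInv : 0 < MInv) (haInv : 0 < aInv) (haW : 0 < aW)
    (hparG : ∀ j (α₀ : ℝ) (U : CfgY 𝔸 (f j).toKIdx), MInv ≤ (geo9Y (f j)).M → 0 < α₀ → (geo9Y (f j)).M * α₀ ≤ aInv →
      (bg9YC 𝔸 G P (f j)).Reg335 c35 α₀ U → ∀ z w, par j U z w ∈ G)
    (hparC : ∀ j β' U a, C37 j β' U a → ∀ z w, par j U z w ∈ G)
    (hunitG : ∀ j (α₀ : ℝ) (U : CfgY 𝔸 (f j).toKIdx), MInv ≤ (geo9Y (f j)).M → 0 < α₀ → (geo9Y (f j)).M * α₀ ≤ aInv →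
      (bg9YC 𝔸 G P (f j)).Reg335 c35 α₀ U → IsUnit (deltaPrimeAY (f j).toKIdx (par j) U))
    (hunitXG : ∀ j (α₀ : ℝ) (U : CfgY 𝔸 (f j).toKIdx), MInv ≤ (geo9Y (f j)).M → 0 < α₀ → (geo9Y (f j)).M * α₀ ≤ aInv →
      (bg9YC 𝔸 G P (f j)).Reg335 c35 α₀ U → IsUnit (XY (f j).toKIdx (par j) (GpY (f j).toKIdx (par j)) U))
    (hsym : ∀ j (U : CfgY 𝔸 (f j).toKIdx) (z w : SiteY (f j).toKIdx), par j U z w = (par j U w z)⁻¹) :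
    CinvFrame₃ c35 (fun j => geo9Y (f j)) (fun j => (codingYx P G (f j) (C37 j) (C38 j)).bg) (fun j => KSC P G (f j) (par j) (C37 j) (C38 j)) b (Fin (d + 1))
      (fun j => SiteY (f j).toKIdx) (fun j => BlkY (f j).toKIdx × ι) (fun j => pullS (codingYx P G (f j) (C37 j) (C38 j)) (CinvY P f G par j)) :=
  { gpFrame₂CodedOnSel P f c35 G b C37 C38 par ιB (fun j => KSC P G (f j) (par j) (C37 j) (C38 j)) hι hG1 (d + 1) M₂ hM₂ hrepr Cq hCq hC37
      (M₂ * ∑ j, ‖b j‖) hcR (fun B _ => (M₂ * ∑ j, ‖b j‖) * B + 1) (fun B _ hB _ => by positivity) (fun δ => δ) (fun δ hδ => hδ)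
      MInv aInv aW hMInv haInv haW hparG hparC hunitG
      (fun j => read342Y_KSC P G (f j) (par j) b (ιB j) (C37 j) (C38 j) (hι j) M₂ hM₂ hrepr c35 MInv aInv)
      (fun j => write342Y_KSC P G (f j) (par j) b (ιB j) (C37 j) (C38 j) (hι j) M₂ hM₂ hrepr aW fun β' U a h => (hC37 j β' U a h).1) with
    blkP := fun j q => ιB j q.1
    κQ := M₂ * ∑ j, ‖b j‖
    cF := (M₂ * ∑ j, ‖b j‖) * Cq + 1
    cK := (Fintype.card ι : ℝ) * (M₂ * ∑ j, ‖b j‖)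
    wK := fun B _ => (M₂ * ∑ j, ‖b j‖) * B + 1
    wKδ := fun δ => δ
    κQ_pos := hcR
    cF_pos := by positivity
    cK_pos := by
      have hne : Nonempty ι := by
        by_contra h
        rw [not_nonempty_iff] at h
        simp at hcR
      exact mul_pos (Nat.cast_pos.2 Fintype.card_pos) hcR
    wK_pos := fun B δ hB _ => by positivity
    wKδ_pos := fun δ hδ => hδ
    Qc := fun j c => QcC (f j).toKIdx (parSelC G (f j).toKIdx (par j) c) b c
    Qcs := fun j c => QcsC (f j).toKIdx (parSelC G (f j).toKIdx (par j) c) b c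
    Cop := fun j c => CopC (f j).toKIdx (parSelC G (f j).toKIdx (par j) c) b c
    Fc := fun j c c' => FcC (f j).toKIdx (parSelC G (f j).toKIdx (par j) c) b c c'
    Fcs := fun j c c' => FcsC (f j).toKIdx (parSelC G (f j).toKIdx (par j) c) b c c'
    hQc := fun j α₀ c _ _ _ hreg => by
      letI : Fintype (geo9K (f j).toKIdx).Site := ‹∀ x : MemberY d ℓ hd hL b₀ b₁ Mstar, Fintype (geo9Y x).Site› (f j)
      letI : DecidableEq (geo9K (f j).toKIdx).Site := instDS (f j)
      obtain ⟨U, rfl, -⟩ := (codingYx P G (f j) (C37 j) (C38 j)).exists_of_bg_Reg335 hreg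
      refine hasMajorantHom_mono _ _ (hasMajorantHom_QcC_base (f j).toKIdx (selY G (f j).toKIdx (par j) U) b (ιB j)
        (fun z w => norm_le_one_and_inv_of_mem G hG1 (selY_mem G (f j).toKIdx (par j) U z w)) hM₂ hrepr) fun a a' => ?_
      split_ifs <;> simp_all
    hQcs := fun j α₀ c _ _ _ hreg => by
      letI : Fintype (geo9K (f j).toKIdx).Site := ‹∀ x : MemberY d ℓ hd hL b₀ b₁ Mstar, Fintype (geo9Y x).Site› (f j)
      letI : DecidableEq (geo9K (f j).toKIdx).Site := instDS (f j)
      obtain ⟨U, rfl, -⟩ := (codingYx P G (f j) (C37 j) (C38 j)).exists_of_bg_Reg335 hreg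
      refine hasMajorantHom_mono _ _ (hasMajorantHom_QcsC_base (f j).toKIdx (selY G (f j).toKIdx (par j) U) b (ιB j)
        (fun z w => norm_le_one_and_inv_of_mem G hG1 (selY_mem G (f j).toKIdx (par j) U z w)) hM₂ hrepr) fun a a' => ?_
      split_ifs <;> simp_all
    cop_eq := fun j c D X hD hXD hDX => copC_eq (f j).toKIdx (parSelC G (f j).toKIdx (par j) c) b c D X hD hDX hXD
    reg_cinv := fun j α₀ c hM hα₀ hMa hreg => by
      obtain ⟨U, rfl, hU⟩ := (codingYx P G (f j) (C37 j) (C38 j)).exists_of_bg_Reg335 hreg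
      have hR : InRegY G (f j).toKIdx (par j) U := ⟨hU.1.1, hparG j α₀ U hM hα₀ hMa hU⟩
      dsimp only [gpFrame₂CodedOnSel]
      erw [parSelC_base_of_inRegY G (f j).toKIdx (par j) hR]
      exact (XC_mul_CopC (f j).toKIdx (par j) b (.base U) (hunitXG j α₀ U hM hα₀ hMa hU)).1
    q_mul := fun j α₁ c c' _ h37 => by
      obtain ⟨U, a, rfl, rfl, _⟩ := (codingYx P G (f j) (C37 j) (C38 j)).exists_of_bg_Cplx337 h37
      exact ⟨qcC_prod (f j).toKIdx (selY G (f j).toKIdx (par j) U) b U a, qcsC_prod (f j).toKIdx (selY G (f j).toKIdx (par j) U) b U a⟩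
    hF := fun j α₁ c c' hα₁ h37 => by
      letI : Fintype (geo9K (f j).toKIdx).Site := ‹∀ x : MemberY d ℓ hd hL b₀ b₁ Mstar, Fintype (geo9Y x).Site› (f j)
      letI : DecidableEq (geo9K (f j).toKIdx).Site := instDS (f j)
      obtain ⟨U, a, rfl, rfl, hC⟩ := (codingYx P G (f j) (C37 j) (C38 j)).exists_of_bg_Cplx337 h37
      have hv : VarParY (f j).toKIdx (par j) Cq α₁ U a := varParY_of_cplxLettersY G (f j) (par j) (ιB j) (hι j) (hsym j) (hC37 j α₁ U a hC).2
      have hR : InRegY G (f j).toKIdx (par j) U := ⟨(hC37 j α₁ U a hC).1, hparC j α₁ U a hC⟩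
      erw [parSelC_base_of_inRegY G (f j).toKIdx (par j) hR]
      have h1 : (M₂ * ∑ j, ‖b j‖) * Cq * α₁ ≤ ((M₂ * ∑ j, ‖b j‖) * Cq + 1) * α₁ := by nlinarith [hα₁.le]
      constructor
      · refine hasMajorantHom_mono _ _ (hasMajorantHom_FcC (f j).toKIdx (par j) b (ιB j) (hι j) hCq hα₁.le hv hM₂ hrepr) fun y y' => ?_
        split_ifs <;> simp_all
      · refine hasMajorantHom_mono _ _ (hasMajorantHom_FcsC (f j).toKIdx (par j) b (ιB j) hCq hα₁.le hv hM₂ hrepr) fun y y' => ?_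
        split_ifs <;> simp_all
    readKer := fun j α₀ c B₁ δ hM hα₀ hMa hreg hB₁ _ hker => by
      obtain ⟨U, rfl, hU⟩ := (codingYx P G (f j) (C37 j) (C38 j)).exists_of_bg_Reg335 hreg
      have hR : InRegY G (f j).toKIdx (par j) U := ⟨hU.1.1, hparG j α₀ U hM hα₀ hMa hU⟩
      erw [parSelC_base_of_inRegY G (f j).toKIdx (par j) hR]
      exact hasMajorant_CopC_base (f j) (par j) b (ιB j) (hι j) hM₂ hrepr U hB₁.le fun y y' => (le_abs_self _).trans (hker y y')
    writeKer := fun j c c' α₁ B δ _ _ h37 hB _ hmaj y y' => by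
      obtain ⟨U, a, rfl, rfl, hC⟩ := (codingYx P G (f j) (C37 j) (C38 j)).exists_of_bg_Cplx337 h37
      have hR : InRegY G (f j).toKIdx (par j) U := ⟨(hC37 j α₁ U a hC).1, hparC j α₁ U a hC⟩
      erw [parSelC_prod_of_inRegY G (f j).toKIdx (par j) hR] at hmaj
      have hpos := geo9Y_len_pos (f j) y
      have hpos' := geo9Y_len_pos (f j) y'
      have h := kerCY_le_of_hasMajorant_CopC (f j) (par j) b (ιB j) (hι j) hM₂ hrepr (.prod U a) hmaj y y'
      rw [pullS_CinvY_ker, abs_of_nonneg (kerCY_nonneg (f j) (par j) _ y y')]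
      exact h.trans (mul_le_mul_of_nonneg_right (mul_le_mul_of_nonneg_right (mul_le_mul_of_nonneg_right (by linarith)
        (Real.rpow_nonneg hpos.le _)) (Real.rpow_nonneg hpos'.le _)) (Real.exp_pos _).le) }

end Ker

/-! ## §3 The (3.44) frame with guarded transporter laws -/

section E4

variable [NormOneClass 𝔸] [FiniteDimensional ℝ 𝔸] {J : Type} (f : J → MemberY d ℓ hd hL b₀ b₁ Mstar)
  [∀ x : MemberY d ℓ hd hL b₀ b₁ Mstar, Fintype (geo9Y x).Site]
  [instDS : ∀ x : MemberY d ℓ hd hL b₀ b₁ Mstar, DecidableEq (geo9Y x).Site] [instNE : ∀ x : MemberY d ℓ hd hL b₀ b₁ Mstar, Nonempty (geo9Y x).Site]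
  (c35 : ℝ) (G : Subgroup 𝔸ˣ) (par : ∀ j : J, SiteParY 𝔸 (f j).toKIdx)
  {ι : Type} [Fintype ι] [DecidableEq ι] (b : Module.Basis ι ℝ 𝔸)
  (ιB : ∀ j : J, BlkY (f j).toKIdx → IBondY (f j).toKIdx)
  (C37 C38 : ∀ j : J, ℝ → CfgY 𝔸 (f j).toKIdx → AfldY 𝔸 (f j).toKIdx → Prop)

/-- ★★ **THE (3.44) FRAME `E4Frame₃` OVER THE CODED CARRIERS OF A SUBFAMILY FOR `KSC₆`, TRANSPORTER LAWS GUARDED** — `B9SectBE4FrameCodedYR.e4Frame₃CodedOn` on the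
root `gpFrame₂CodedOnSel` (`KSC₆`'s dictionaries, writing function `wE4₆`, rate `4δc∕5`); `e4_transfer` = `e4_transfer_KSC₆` at the base of a (3.37) pair, where the
selected transporter IS `par` (`hparC`). [cite: Balaban1985BackgroundPropagators, Thm 3.4 p.400, (3.44) p.398, p.403 l.2–5, (3.60)–(3.65) pp.402–403, (3.35)–(3.37) p.396; Balaban1984PropagatorsII, Lemma 2.1 p.234, (2.51)–(2.52) p.232] -/
noncomputable def e4Frame₃CodedOnSel (hι : ∀ (j : J) (s : BlkY (f j).toKIdx), β (f j).toKIdx.hN (f j).toKIdx.D (f j).toKIdx.hk (ιB j s) = s)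
    (hG1 : ∀ u : 𝔸ˣ, u ∈ G → ‖(u : 𝔸)‖ ≤ 1)
    (dB : ℕ) (M₂ : ℝ) (hM₂ : 0 ≤ M₂) (hrepr : ∀ (v : 𝔸) (j : ι), |b.repr v j| ≤ M₂ * ‖v‖) (hcR : 0 < M₂ * ∑ j, ‖b j‖)
    (Cq : ℝ) (hCq : 0 ≤ Cq) (hC37 : ∀ j β' U a, C37 j β' U a → GVal G (f j).toKIdx U ∧ CplxLettersY G (f j) (par j) (ιB j) Cq β' U a)
    (MInv aInv aW : ℝ) (hMInv : 0 < MInv) (haInv : 0 < aInv) (haW : 0 < aW)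
    (hparG : ∀ j (α₀ : ℝ) (U : CfgY 𝔸 (f j).toKIdx), MInv ≤ (geo9Y (f j)).M → 0 < α₀ → (geo9Y (f j)).M * α₀ ≤ aInv →
      (bg9YC 𝔸 G P (f j)).Reg335 c35 α₀ U → ∀ z w, par j U z w ∈ G)
    (hparC : ∀ j β' U a, C37 j β' U a → ∀ z w, par j U z w ∈ G)
    (hunitG : ∀ j (α₀ : ℝ) (U : CfgY 𝔸 (f j).toKIdx), MInv ≤ (geo9Y (f j)).M → 0 < α₀ → (geo9Y (f j)).M * α₀ ≤ aInv →
      (bg9YC 𝔸 G P (f j)).Reg335 c35 α₀ U → IsUnit (deltaPrimeAY (f j).toKIdx (par j) U)) :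
    E4Frame₃ c35 (fun j => geo9Y (f j)) (fun j => (codingYx P G (f j) (C37 j) (C38 j)).bg) (fun j => KSC₆ P G (f j) (par j) (C37 j) (C38 j)) b
      (Fin (d + 1)) (fun j => SiteY (f j).toKIdx) :=
  { gpFrame₂CodedOnSel P f c35 G b C37 C38 par ιB (fun j => KSC₆ P G (f j) (par j) (C37 j) (C38 j)) hι hG1 dB M₂ hM₂ hrepr Cq hCq hC37
      (M₂ * ∑ j, ‖b j‖) hcR (fun B _ => (M₂ * ∑ j, ‖b j‖) * B + 1) (fun B _ hB _ => by positivity) (fun δ => δ) (fun δ hδ => hδ)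
      MInv aInv aW hMInv haInv haW hparG hparC hunitG
      (fun j => read342Y_KSC₆ P G (f j) (par j) b (ιB j) (C37 j) (C38 j) (hι j) M₂ hM₂ hrepr c35 MInv aInv)
      (fun j => write342Y_KSC₆ P G (f j) (par j) b (ιB j) (C37 j) (C38 j) (hι j) M₂ hM₂ hrepr aW fun β' U a h => (hC37 j β' U a h).1) with
    wE4 := fun B δc Bε => wE4₆ (2 * ((d : ℝ) + 1)) (∑ j, ‖b j‖) M₂ B δc Bε
    wE4δ := fun δc => 4 / 5 * δc
    wE4δ_pos := fun δc hδc => by positivity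
    e4_transfer := fun j α₀ c c' α₁ B₀ B δ δc Bε hM hα₀ hMa hreg hα₁ haW' h37 hB₀ hB hδ hδc hδcδ hE hE4 HV => by
      obtain ⟨U, a, rfl, rfl, hC⟩ := (codingYx P G (f j) (C37 j) (C38 j)).exists_of_bg_Cplx337 h37
      have hR : InRegY G (f j).toKIdx (par j) U := ⟨(hC37 j α₁ U a hC).1, hparC j α₁ U a hC⟩
      dsimp only [gpFrame₂CodedOnSel] at HV
      erw [parSelC_base_of_inRegY G (f j).toKIdx (par j) hR] at HV
      exact e4_transfer_KSC₆ P c35 G (f j) (par j) b (ιB j) (C37 j) (C38 j) (hι j) hG1 hM₂ hrepr hcR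
        (read342Y_KSC₆ P G (f j) (par j) b (ιB j) (C37 j) (C38 j) (hι j) M₂ hM₂ hrepr c35 MInv aInv)
        α₀ (.base U) (.mult a) α₁ B₀ B δ δc Bε hM hα₀ hMa hreg hα₁ haW' h37 hB₀ hB hδ hδc hδcδ hE hE4 HV }

end E4

end Literature.MathematicalPhysics.QuantumFieldTheory.Balaban1983to89.B9SectBFramesSelY

end
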